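import Summits.HubbardSuperconductivity.HubbardSuperconductivity.Theses.KacWindowPenalty
import Literature.MathematicalPhysics.QuantumLattice.PairFieldMomentum
import Literature.MathematicalPhysics.QuantumLattice.ApproximateEigenvectorLemmas
import Literature.MathematicalPhysics.QuantumLattice.DWaveSourceProofs

/-!
# Crux `WindowInfraredBound` (item `stmt-HubbardSuperconductivity-1089`): the Parseval ceiling

The crux (`Theses.KacWindowPenalty.WindowInfraredBound`; the copy `Theses.FunctionFieldCertificate.WindowInfraredBound`
is the same term — this file imports the KacWindowPenalty route file only) asks, at every `(U, δ)`, for constants `C, ε₀, L₀` with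
`T_ε(ψ) := Σ_{m ≠ 0, |q_m| ≤ ε} ‖Δ_d(m) ψ‖² / L² ≤ C ε L²` for every `ε ∈ (0, ε₀]`, every even `L ≥ L₀`
and every normalised `(N_L, S^z = 0)`-sector ground state `ψ` of `hubbardTorus 2 L 1 U`.
Negative-side bookkeeping of the standing disprover (cdisprove cycle 1); no definition is introduced,
every statement is spelled out over the tree's `pairStructureFactor` / `momentumNormSq` / `pairFieldAt`:

* (used silently, by definitional unfolding) the route's `let D := …` summand and window condition ARE
  `pairStructureFactor dWaveFormFactor L ψ m` and `momentumNormSq L m ≤ ε²`.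
* `windowSum_le_localPairSum`, `localPair_dWave_mulVec_normSq_le` (`‖P_x ψ‖² ≤ 32‖ψ‖²`, from
  `norm_localPair_le`: `‖P_x‖ ≤ 8/√2`), `windowSum_le_thirtyTwo_mul_sq` — **Parseval ceiling**
  `T_ε(ψ) ≤ Σ_x ‖P_x ψ‖² ≤ 32 L²` for EVERY normalised Fock vector: no Hamiltonian, no ground state.
  Hence `windowSum_le_of_thirtyTwo_le`: the crux's inequality is automatic whenever `32 ≤ C ε`; its whole
  content is the factor `Cε/32` as `ε → 0` (non-triviality threshold for provers AND refuters).
* `windowSum_eq_zero_of_sq_lt` — empty window: `ε² < (2π/L)²` gives `T_ε = 0`; only pairs with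
  `ε L ≥ 2π` bind, where the right-hand side is `≥ 2π C L` (a counterexample needs `S_ψ(q_min) ≳ C L`,
  i.e. `Θ(L)` condensed pairs at the smallest momentum, not `O(1)`).
* `windowInfraredBound_allEps` — **`ε₀` is cosmetic**: the crux yields the same bound for ALL `ε > 0`
  with constant `max C (32/ε₀)`.

Calibration (kit job `j015079`, evidence on the item): at `U = 0` (Slater sector ground state, Wick),
`δ ∈ {0.1, 0.2, 0.3, 0.45}`, `L ≤ 256`: `S_ψ` is bounded (`S_ψ(0) ≈ 3.0, 2.2, 1.5, 0.8`), and
`T_ε ≈ κ ε² L²` with `κ ≈ 0.21, 0.15, 0.10, 0.055`; `sup_ε T_ε/(εL²) ≈ 0.20 ≪ 32`.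
Workfile with the attack log: `Cruxes/WindowInfraredBound/Disproof.lean`.
-/

noncomputable section

namespace Summit.HubbardSuperconductivity.HubbardSuperconductivity.Theorems.WindowInfraredBound.Negative

open Literature.MathematicalPhysics.QuantumLattice Literature.Probability.LatticeModels Matrix Finset
open Summit.HubbardSuperconductivity.HubbardSuperconductivity.Theses.KacWindowPenalty
open scoped Matrix.Norms.L2Operator ComplexOrder

variable (L : ℕ) [NeZero L]

/-- **Parseval ceiling, step 1**: dropping the window indicator, `T_ε(ψ) ≤ Σ_m S_ψ(m) = Σ_x ‖P_x ψ‖²`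
for EVERY Fock vector (no ground-state input). [cite: KLS1988PRL, p. 2582] -/
theorem windowSum_le_localPairSum (ε : ℝ) (ψ : Fock (Orb (FermionTorus 2 L))) :
    (∑ m : TorusSite 2 L, if m ≠ 0 ∧ momentumNormSq L m ≤ ε ^ 2 then
        pairStructureFactor dWaveFormFactor L ψ m else 0) ≤
      ∑ x : TorusSite 2 L, (star (localPair dWaveFormFactor L x *ᵥ ψ) ⬝ᵥ
        (localPair dWaveFormFactor L x *ᵥ ψ)).re := by
  rw [← sum_pairStructureFactor]
  refine Finset.sum_le_sum fun m _ => ?_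
  split_ifs
  · exact le_rfl
  · exact pairStructureFactor_nonneg _ _ _ _

/-- `Σ_{e ∈ {0, ±e₁, ±e₂}} |d(e)/√2| = 4/√2` for the `d_{x²-y²}` form factor. [folklore] -/
theorem sum_abs_dWaveFormFactor_div_sqrt_two :
    ∑ e ∈ insert (0 : Site 2) unitSteps, |dWaveFormFactor e / Real.sqrt 2| = 4 * (1 / Real.sqrt 2) := by
  have h1 : dWaveFormFactor (Pi.single 0 1) = 1 := if_pos (Or.inl rfl)
  have h2 : dWaveFormFactor (-Pi.single 0 1) = 1 := if_pos (Or.inr rfl)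
  have hne1 : ¬ ((Pi.single 1 1 : Site 2) = Pi.single 0 1 ∨ (Pi.single 1 1 : Site 2) = -Pi.single 0 1) := by
    decide
  have hne2 : ¬ ((-Pi.single 1 1 : Site 2) = Pi.single 0 1 ∨ (-Pi.single 1 1 : Site 2) = -Pi.single 0 1) := by
    decide
  have h3 : dWaveFormFactor (Pi.single 1 1) = -1 := by
    unfold dWaveFormFactor; rw [if_neg hne1, if_pos (Or.inl rfl)]
  have h4 : dWaveFormFactor (-Pi.single 1 1) = -1 := by
    unfold dWaveFormFactor; rw [if_neg hne2, if_pos (Or.inr rfl)]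
  have hs2 : (0 : ℝ) < Real.sqrt 2 := Real.sqrt_pos.2 two_pos
  have ha : |(1 : ℝ) / Real.sqrt 2| = 1 / Real.sqrt 2 := abs_of_pos (div_pos one_pos hs2)
  have hb : |(-1 : ℝ) / Real.sqrt 2| = 1 / Real.sqrt 2 := by
    rw [neg_div, abs_neg, ha]
  simp only [unitSteps]
  rw [Finset.sum_insert (by decide), Finset.sum_insert (by decide), Finset.sum_insert (by decide),
    Finset.sum_insert (by decide), Finset.sum_singleton, dWaveFormFactor_zero, h1, h2, h3, h4, zero_div,
    abs_zero, ha, hb]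
  ring

/-- **Operator norm of the local `d`-wave pair**: `‖P_x‖ ≤ 8/√2 = 4√2` (`‖c‖ ≤ 1`, four bonds, two
spin orderings, weight `1/√2`). [cite: Scalapino1995, §2] -/
theorem norm_localPair_dWave_le (x : TorusSite 2 L) :
    ‖localPair dWaveFormFactor L x‖ ≤ 8 * (1 / Real.sqrt 2) := by
  have h := norm_localPair_le dWaveFormFactor L x
  rw [sum_abs_dWaveFormFactor_div_sqrt_two] at h
  linarith

/-- `(8/√2)² = 32`. [folklore] -/
theorem eight_div_sqrt_two_sq : (8 * (1 / Real.sqrt 2) : ℝ) ^ 2 = 32 := by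
  rw [mul_pow, div_pow, one_pow, Real.sq_sqrt two_pos.le]
  norm_num

/-- **Local pair weight bound**: `‖P_x ψ‖² ≤ 32 ‖ψ‖²` for every Fock vector. [cite: Scalapino1995, §2] -/
theorem localPair_dWave_mulVec_normSq_le (x : TorusSite 2 L) (ψ : Fock (Orb (FermionTorus 2 L))) :
    (star (localPair dWaveFormFactor L x *ᵥ ψ) ⬝ᵥ (localPair dWaveFormFactor L x *ᵥ ψ)).re ≤
      32 * (star ψ ⬝ᵥ ψ).re := by
  rw [← eucNorm_sq, ← eucNorm_sq, ← eight_div_sqrt_two_sq, ← mul_pow]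
  have h0 : 0 ≤ eucNorm (localPair dWaveFormFactor L x *ᵥ ψ) := eucNorm_nonneg _
  have h1 : eucNorm (localPair dWaveFormFactor L x *ᵥ ψ) ≤ 8 * (1 / Real.sqrt 2) * eucNorm ψ :=
    (eucNorm_mulVec_le _ _).trans
      (mul_le_mul_of_nonneg_right (norm_localPair_dWave_le L x) (eucNorm_nonneg _))
  exact pow_le_pow_left₀ h0 h1 2

/-- **Parseval ceiling**: for every NORMALISED Fock vector and every `ε`,
`T_ε(ψ) ≤ Σ_x ‖P_x ψ‖² ≤ 32 L²` — no Hamiltonian, no ground state. The crux asserts the improvement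
factor `Cε/32` over this for sector ground states; it is therefore AUTOMATIC at `ε ≥ 32/C` and has content
only as `ε → 0`. [cite: KLS1988PRL, p. 2582] -/
theorem windowSum_le_thirtyTwo_mul_sq (ε : ℝ) {ψ : Fock (Orb (FermionTorus 2 L))}
    (hψ : star ψ ⬝ᵥ ψ = 1) :
    (∑ m : TorusSite 2 L, if m ≠ 0 ∧ momentumNormSq L m ≤ ε ^ 2 then
        pairStructureFactor dWaveFormFactor L ψ m else 0) ≤ 32 * (L : ℝ) ^ 2 := by
  refine (windowSum_le_localPairSum L ε ψ).trans ?_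
  calc ∑ x : TorusSite 2 L, (star (localPair dWaveFormFactor L x *ᵥ ψ) ⬝ᵥ
          (localPair dWaveFormFactor L x *ᵥ ψ)).re
      ≤ ∑ _x : TorusSite 2 L, (32 : ℝ) := Finset.sum_le_sum fun x _ => by
          simpa [hψ] using localPair_dWave_mulVec_normSq_le L x ψ
    _ = 32 * (L : ℝ) ^ 2 := by
          have hcard : Fintype.card (TorusSite 2 L) = L ^ 2 := by simp [TorusSite, ZMod.card]
          rw [Finset.sum_const, Finset.card_univ, hcard, nsmul_eq_mul]
          push_cast; ring

/-- **The bound of the crux is automatic once `32 ≤ C ε`** (every normalised vector, no ground-state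
hypothesis): the content of `WindowInfraredBound` is the regime `ε → 0`. [folklore] -/
theorem windowSum_le_of_thirtyTwo_le {C ε : ℝ} (hCε : 32 ≤ C * ε) {ψ : Fock (Orb (FermionTorus 2 L))}
    (hψ : star ψ ⬝ᵥ ψ = 1) :
    (∑ m : TorusSite 2 L, if m ≠ 0 ∧ momentumNormSq L m ≤ ε ^ 2 then
        pairStructureFactor dWaveFormFactor L ψ m else 0) ≤ C * ε * (L : ℝ) ^ 2 :=
  (windowSum_le_thirtyTwo_mul_sq L ε hψ).trans (mul_le_mul_of_nonneg_right hCε (sq_nonneg _))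

omit [NeZero L] in
/-- A nonzero momentum label has `Σᵢ (valMinAbs mᵢ)² ≥ 1`. [folklore] -/
theorem one_le_sum_valMinAbs_sq {m : TorusSite 2 L} (hm : m ≠ 0) :
    (1 : ℝ) ≤ ∑ i, (((m i).valMinAbs : ℤ) : ℝ) ^ 2 := by
  obtain ⟨i, hi⟩ : ∃ i, m i ≠ 0 := by
    by_contra h
    push Not at h
    exact hm (funext h)
  have hv : (m i).valMinAbs ≠ 0 := fun h => hi ((ZMod.valMinAbs_eq_zero (m i)).1 h)
  have h1 : (1 : ℝ) ≤ (((m i).valMinAbs : ℤ) : ℝ) ^ 2 := by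
    have : (1 : ℤ) ≤ (m i).valMinAbs ^ 2 := by
      have := Int.one_le_abs hv
      nlinarith [abs_nonneg ((m i).valMinAbs), sq_abs ((m i).valMinAbs)]
    exact_mod_cast this
  exact h1.trans (Finset.single_le_sum (f := fun i => (((m i).valMinAbs : ℤ) : ℝ) ^ 2)
    (fun j _ => sq_nonneg _) (Finset.mem_univ i))

/-- **Empty window**: if `ε² < (2π/L)²` no nonzero label lies in the window and `T_ε(ψ) = 0`; the crux
binds only pairs `(ε, L)` with `ε L ≥ 2π`, where its right-hand side is `≥ 2π C L`. [folklore] -/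
theorem windowSum_eq_zero_of_sq_lt {ε : ℝ} (hε : ε ^ 2 < (2 * Real.pi / (L : ℝ)) ^ 2)
    (ψ : Fock (Orb (FermionTorus 2 L))) :
    (∑ m : TorusSite 2 L, if m ≠ 0 ∧ momentumNormSq L m ≤ ε ^ 2 then
        pairStructureFactor dWaveFormFactor L ψ m else 0) = 0 := by
  refine Finset.sum_eq_zero fun m _ => ?_
  rw [if_neg]
  rintro ⟨hm, hle⟩
  have h1 := one_le_sum_valMinAbs_sq L hm
  have hpos : 0 ≤ (2 * Real.pi / (L : ℝ)) ^ 2 := sq_nonneg _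
  have : (2 * Real.pi / (L : ℝ)) ^ 2 ≤ momentumNormSq L m := by
    rw [momentumNormSq_apply]
    nlinarith
  linarith

/-- **`ε₀` is cosmetic.** From the crux one gets the same bound for ALL `ε > 0` (constant
`max C (32/ε₀)`), by the Parseval ceiling above `ε₀`. So a prover may fix any convenient `ε₀`, and a
refuter gains nothing from large `ε`. [folklore] -/
theorem windowInfraredBound_allEps (h : WindowInfraredBound) :
    ∀ U : ℝ, 0 < U → ∀ δ ∈ Set.Ioo (0:ℝ) (1 / 2), ∃ C : ℝ, 0 ≤ C ∧ ∃ L₀ : ℕ,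
      ∀ ε : ℝ, 0 < ε → ∀ (L : ℕ) [NeZero L], L₀ ≤ L → Even L →
        ∀ ψ : Fock (Orb (FermionTorus 2 L)), star ψ ⬝ᵥ ψ = 1 →
          IsGroundStateInSector (hubbardTorus 2 L 1 U) (2 * ⌊(1 - δ) * (L : ℝ) ^ 2 / 2⌋₊) 0 ψ →
            (∑ m : TorusSite 2 L, if m ≠ 0 ∧ momentumNormSq L m ≤ ε ^ 2 then
                pairStructureFactor dWaveFormFactor L ψ m else 0) ≤ C * ε * (L : ℝ) ^ 2 := by
  intro U hU δ hδ
  -- the route's inlined `let D := …` summand / window condition are definitionally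
  -- `pairStructureFactor dWaveFormFactor L ψ m` / `momentumNormSq L m ≤ ε²`
  obtain ⟨C, ε₀, hC, hε₀, L₀, hmain⟩ :
      ∃ C ε₀ : ℝ, 0 ≤ C ∧ 0 < ε₀ ∧ ∃ L₀ : ℕ, ∀ ε ∈ Set.Ioc (0:ℝ) ε₀, ∀ (L : ℕ) [NeZero L], L₀ ≤ L → Even L →
        ∀ ψ : Fock (Orb (FermionTorus 2 L)), star ψ ⬝ᵥ ψ = 1 →
          IsGroundStateInSector (hubbardTorus 2 L 1 U) (2 * ⌊(1 - δ) * (L : ℝ) ^ 2 / 2⌋₊) 0 ψ →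
            (∑ m : TorusSite 2 L, if m ≠ 0 ∧ momentumNormSq L m ≤ ε ^ 2 then
                pairStructureFactor dWaveFormFactor L ψ m else 0) ≤ C * ε * (L : ℝ) ^ 2 :=
    h U hU δ hδ
  refine ⟨max C (32 / ε₀), le_max_of_le_left hC, L₀, fun ε hε L _ hL hev ψ hψ hgs => ?_⟩
  rcases le_or_gt ε ε₀ with hle | hlt
  · exact (hmain ε ⟨hε, hle⟩ L hL hev ψ hψ hgs).trans
      (mul_le_mul_of_nonneg_right (mul_le_mul_of_nonneg_right (le_max_left _ _) hε.le) (sq_nonneg _))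
  · refine windowSum_le_of_thirtyTwo_le L ?_ hψ
    calc (32 : ℝ) = 32 / ε₀ * ε₀ := by field_simp
      _ ≤ 32 / ε₀ * ε := mul_le_mul_of_nonneg_left hlt.le (by positivity)
      _ ≤ max C (32 / ε₀) * ε := mul_le_mul_of_nonneg_right (le_max_right _ _) hε.le

end Summit.HubbardSuperconductivity.HubbardSuperconductivity.Theorems.WindowInfraredBound.Negative

end
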